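import Summits.ResolutionOfSingularities.ResolutionOfSingularities.Theorems.EquisingularLiftEquisingularLiftNatSpecimenFermatConeChartRings
import Summits.ResolutionOfSingularities.ResolutionOfSingularities.Theorems.EquisingularLiftEquisingularLiftNatSpecimenWhitneyCubicCharts
import HarnessLib

/-!
# [OURS · L1 W4.5(b)] EL♮ specimen family T-ISO-CONE — the FERMAT CONES `H_d = V₊(x₁ᵈ + x₂ᵈ + x₃ᵈ) ⊂ ℙ³_k`:
# `Bl_vertex H_d` is regular, and EL♮ holds for `H_d` (crux `Theses.EquisingularLift.EquisingularLiftNat`, stmt-ResolutionOfSingularities-20038)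

NOT a statement of any manuscript; OURS kernel specimen (cell `res-hironaka`, chain w45b, CHAIN v7.4 §3 row T-ISO-1, step 0;
seat res-D-pv-013, own initiative, counted 0). AI-written, weaker than expert review.

`H_d = V₊(x₁ᵈ + x₂ᵈ + x₃ᵈ) ⊂ ℙ³_k` (the tree's reduced hypersurface, `…FermatConeForms`), `k` algebraically closed of characteristic
`p ∤ d` (`d ≠ 0` in `k`, `d ≥ 1`): the cone over the Fermat plane curve of degree `d`, whose only singular point is the VERTEX
`[1:0:0:0] = V(Λ)`, `Λ = ker Proj(f_k)` the kill-map linear centre with `r = 0`, `m = 3` (`StrataSplit.LinearCentre`, keeping `x₀` and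
killing `x₁, x₂, x₃`). This file proves, on the pattern of res-D-pv-022's R2 `…WhitneyCubicCharts` (p511043, the case `r = 1`, `m = 2`):

* `isRegular_of_isBlowup_comap` — **every blow-up of `H_d` along `Λ · 𝒪_{H_d}` is a regular scheme**: over `D₊(x_c)` the blow-up restricts
  to a blow-up of `Spec (ChartRing F_d c)` along `(x₁/x_c, x₂/x_c, x₃/x_c)~` (`comap_chart_eq_ofIdealTop`); for `c ≠ 0` that ideal contains
  `x_c/x_c = 1` and the chart ring `≅ k[y]/(1 + y₁ᵈ + y₂ᵈ)` is regular; for `c = 0` the charts at the generators (Stacks 0804) are spectra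
  of regular rings (`…FermatConeChartRings.isRegularRing_blowupAlgebra_tautVec`, from `…FermatConeAlgebra.isRegularRing_vertexChart`);
* `support_subset_range`, `not_range_subset_support` — `V(Λ) = {[1:0:0:0]} ⊆ ι(H_d)` and `ι(H_d) ⊄ V(Λ)`;
* `elNatAt_fermatCone` — **EL♮ HOLDS FOR EVERY FERMAT CONE `H_d`, `p ∤ d`**: `Theorems.EquisingularLift.ELNatAt p k 3 H_d ι` (p503491) by
  ONE horizontal E1 step, the blow-up of `ℙ³_{𝕎(k)}` along the `O`-point `V(x₁, x₂, x₃)` = THE SECTION THROUGH THE VERTEX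
  (`elNatAt_of_oneStep₀`, p505461; centre `≅ ℙ⁰_O` regular and `O`-flat, `C · 𝒪_{ℙ³_k} = Λ` by `LinearCentre.comap_ker_projMap_kill`).

Census value: the first ISOLATED-singularity instances of EL♮ closed by name in the kernel (ordinary `d`-fold points: `A₁`-cone `d = 2`,
simple-elliptic `Ẽ₆` `d = 3`, non-rational cone singularities `d ≥ 4`) — the base case «one point blow-up resolves» of res-L1-w45b-lead-2's
T-ISO-0 / `stub_elnat_three_isolated`, realised without the multisection device.
-/

set_option linter.dupNamespace false -- mandated namespace `Summit.<Summit>.<Problem>` of this single-conjunct summit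

noncomputable section

open CategoryTheory CategoryTheory.Limits AlgebraicGeometry TopologicalSpace
open MvPolynomial HomogeneousLocalization
open Literature.AlgebraicGeometry.Resolution
open Literature.AlgebraicGeometry.Motives Literature.AlgebraicGeometry.Motives.SmoothHypersurface
open Literature.AlgebraicGeometry.Motives.ProjectiveSpace
open AlgebraicGeometry.Scheme.IdealSheafData
open Summit.ResolutionOfSingularities.ResolutionOfSingularities.Cruxes.EquisingularLift.StrataSplit

namespace Summit.ResolutionOfSingularities.ResolutionOfSingularities.Cruxes.EquisingularLiftNat.Sections

namespace FermatCone

variable (k : Type) [Field k] (d : ℕ)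

attribute [local instance] MvPolynomial.gradedAlgebra ProjBaseChange.algebraBase

/-! ## The kill-map centre `Λ = V₊(x₁, x₂, x₃)` (the vertex) and the hypersurface -/

section Kill

variable (fk : homogeneousSubmodule (Fin (0 + 3 + 1)) k →+*ᵍ homogeneousSubmodule (Fin (0 + 1)) k)
  (hfk' : HomogeneousIdeal.irrelevant (homogeneousSubmodule (Fin (0 + 1)) k) ≤
    (HomogeneousIdeal.irrelevant (homogeneousSubmodule (Fin (0 + 3 + 1)) k)).map fk) (hfkC : ∀ a : k, fk (C a) = C a)
  (hfkX : ∀ i : Fin (0 + 3 + 1), fk (X i) = if h : (i : ℕ) < 0 + 1 then X ⟨i, h⟩ else 0)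

include hfkC hfkX in
/-- Points of `V(Λ) = Proj(f_k)(ℙ⁰_k)` lie in `V₊(x₁) ∩ V₊(x₂) ∩ V₊(x₃)`: `x_a` (`a ≥ 1`) belongs to their homogeneous prime
(`Proj.map_preimage_basicOpen`, `f_k(x_a) = 0`). [folklore] -/
theorem X_mem_of_mem_support {x : Proj (homogeneousSubmodule (Fin (0 + 3 + 1)) k)}
    (hx : x ∈ ((Proj.map fk hfk').ker.support : Set (Proj (homogeneousSubmodule (Fin (0 + 3 + 1)) k))))
    (a : Fin (0 + 3 + 1)) (ha : 0 + 1 ≤ (a : ℕ)) :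
    (X a : MvPolynomial (Fin (0 + 3 + 1)) k) ∈ x.asHomogeneousIdeal := by
  haveI : IsClosedImmersion (Proj.map fk hfk') :=
    Literature.AlgebraicGeometry.FundamentalGroup.isClosedImmersion_projMap_of_surjective fk hfk'
      (EquisingularLift.StrataSplit.LinearCentre.kill_surjective (r := 0) (m := 3) fk.toRingHom (fun a => hfkC a) (fun i => hfkX i))
  have hsupp : ((Proj.map fk hfk').ker.support : Set (Proj (homogeneousSubmodule (Fin (0 + 3 + 1)) k))) =
      Set.range (Proj.map fk hfk') := by
    rw [Scheme.Hom.support_ker, (Proj.map fk hfk').isClosedEmbedding.isClosed_range.closure_eq]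
  rw [hsupp] at hx
  obtain ⟨y, rfl⟩ := hx
  by_contra hmem
  have hy : y ∈ Proj.map fk hfk' ⁻¹ᵁ Proj.basicOpen (homogeneousSubmodule (Fin (0 + 3 + 1)) k) (X a) :=
    (ProjectiveSpectrum.mem_basicOpen _ _ _).mpr hmem
  rw [Proj.map_preimage_basicOpen, hfkX a, dif_neg (by omega)] at hy
  exact (Proj.mem_basicOpen _ _ _).mp hy (Ideal.zero_mem _)

include hfkC hfkX in
/-- **`V(Λ) ⊆ V₊(F_d) = ι(H_d)`** (`F_d = x₁ᵈ + x₂ᵈ + x₃ᵈ ∈ (x₁, x₂, x₃)` for `d ≥ 1`): the E1 clause at level `0`. [folklore] -/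
theorem support_subset_range (hd : 0 < d) :
    ((Proj.map fk hfk').ker.support : Set (Proj (homogeneousSubmodule (Fin (0 + 3 + 1)) k))) ⊆
      Set.range (hypersurfaceι (form k d)).left := by
  intro x hx
  have h1 := X_mem_of_mem_support k fk hfk' hfkC hfkX hx 1 (by decide)
  have h2 := X_mem_of_mem_support k fk hfk' hfkC hfkX hx 2 (by decide)
  have h3 := X_mem_of_mem_support k fk hfk' hfkC hfkX hx 3 (by decide)
  refine (Set.ext_iff.mp (range_hypersurfaceι (form k d)) x).mpr
    ((ProjectiveSpectrum.mem_zeroLocus _ _ _).mpr (Set.singleton_subset_iff.mpr ?_))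
  change form k d ∈ x.asHomogeneousIdeal
  rw [form]
  exact Ideal.add_mem _ (Ideal.add_mem _ (Ideal.pow_mem_of_mem _ h1 d hd) (Ideal.pow_mem_of_mem _ h2 d hd))
    (Ideal.pow_mem_of_mem _ h3 d hd)

/-- `x₁ ∉ (F_d)` (`k` algebraically closed, `d ≠ 0` in `k`): evaluate at `(0, 1, ζ, 0)`, `ζᵈ = −1`. [folklore] -/
theorem X_one_not_mem_span_form [IsAlgClosed k] (hdk : (d : k) ≠ 0) :
    (X 1 : MvPolynomial (Fin 4) k) ∉ Ideal.span {form k d} := by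
  have hd1 : 1 ≤ d := Nat.one_le_iff_ne_zero.mpr (by rintro rfl; exact hdk (by simp))
  obtain ⟨ζ, hζ⟩ := IsAlgClosed.exists_pow_nat_eq (-1 : k) (n := d) hd1
  intro h
  obtain ⟨q, hq⟩ := Ideal.mem_span_singleton'.mp h
  have h := congrArg (MvPolynomial.eval ![(0 : k), 1, ζ, 0]) hq
  rw [form] at h
  simp [hζ, zero_pow (by omega : d ≠ 0)] at h

include hfkC hfkX in
/-- **`ι(H_d) ⊄ V(Λ)`**: the generic point `(F_d)` of `H_d` lies in `D₊(x₁)`. [folklore] -/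
theorem not_range_subset_support [IsAlgClosed k] (hdk : (d : k) ≠ 0) :
    ¬ (Set.range (hypersurfaceι (form k d)).left ⊆
      ((Proj.map fk hfk').ker.support : Set (Proj (homogeneousSubmodule (Fin (0 + 3 + 1)) k)))) := by
  intro h
  have hmem : (pointOfPrime (form k d) (isHomogeneous_form k d) (prime_form k d hdk) :
      Proj (homogeneousSubmodule (Fin (0 + 3 + 1)) k)) ∈ Set.range (hypersurfaceι (form k d)).left := by
    refine (Set.ext_iff.mp (range_hypersurfaceι (form k d)) _).mpr
      ((ProjectiveSpectrum.mem_zeroLocus _ _ _).mpr (Set.singleton_subset_iff.mpr ?_))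
    exact Ideal.subset_span rfl
  have h1 := X_mem_of_mem_support k fk hfk' hfkC hfkX (h hmem) 1 (by decide)
  exact X_one_not_mem_span_form k d hdk h1

end Kill

/-! ## The centre on the chart `Spec (ChartRing F_d c) → ℙ³_k` -/

section Chart

variable (fk : homogeneousSubmodule (Fin (0 + 3 + 1)) k →+*ᵍ homogeneousSubmodule (Fin (0 + 1)) k)
  (hfk' : HomogeneousIdeal.irrelevant (homogeneousSubmodule (Fin (0 + 1)) k) ≤
    (HomogeneousIdeal.irrelevant (homogeneousSubmodule (Fin (0 + 3 + 1)) k)).map fk) (hfkC : ∀ a : k, fk (C a) = C a)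
  (hfkX : ∀ i : Fin (0 + 3 + 1), fk (X i) = if h : (i : ℕ) < 0 + 1 then X ⟨i, h⟩ else 0)
  (hd : 0 < d) (c : Fin 4)

/-- `Spec (ChartRing F_d c) → H_d ↪ ℙ³_k` is `Spec (k[x]_{(x_c)} → ChartRing F_d c)` followed by `D₊(x_c) ↪ ℙ³_k`
(`SmoothHypersurface.chart_hypersurfaceι` on underlying schemes). [folklore] -/
theorem chart_left_comp_ι :
    (chart (form k d) c (isHomogeneous_form k d) hd).left ≫ (hypersurfaceι (form k d)).left =
      Spec.map (CommRingCat.ofHom (toChartRing (form k d) c (isHomogeneous_form k d)).toRingHom) ≫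
        Proj.awayι (homogeneousSubmodule (Fin (2 + 1 + 1)) k) (X c) (X_mem c) one_pos := by
  have h := congrArg (fun f => f.left) (chart_hypersurfaceι (form k d) c (isHomogeneous_form k d) hd)
  simp only [Over.comp_left, specOverOfAlgHom_left, awayChartι_left] at h
  exact h

/-- **Pulling a section `b` of `D₊(x_c)` back to `Spec (ChartRing F_d c)`** gives `[b]` (through `Γ(Spec A, ⊤) ≅ A`). [folklore] -/
theorem appLE_chart_awayToSection
    (hle : (⊤ : (Spec (CommRingCat.of (ChartRing (form k d) c (isHomogeneous_form k d)))).Opens) ≤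
      (Spec.map (CommRingCat.ofHom (toChartRing (form k d) c (isHomogeneous_form k d)).toRingHom) ≫
        Proj.awayι (homogeneousSubmodule (Fin (2 + 1 + 1)) k) (X c) (X_mem c) one_pos) ⁻¹ᵁ
          Proj.basicOpen (homogeneousSubmodule (Fin (2 + 1 + 1)) k) (X c))
    (b : Away (homogeneousSubmodule (Fin (2 + 1 + 1)) k) (X c)) :
    ((Spec.map (CommRingCat.ofHom (toChartRing (form k d) c (isHomogeneous_form k d)).toRingHom) ≫
        Proj.awayι (homogeneousSubmodule (Fin (2 + 1 + 1)) k) (X c) (X_mem c) one_pos).appLE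
        (Proj.basicOpen (homogeneousSubmodule (Fin (2 + 1 + 1)) k) (X c)) ⊤ hle).hom
        ((Proj.awayToSection (homogeneousSubmodule (Fin (2 + 1 + 1)) k) (X c)).hom b) =
      (Scheme.ΓSpecIso (CommRingCat.of (ChartRing (form k d) c (isHomogeneous_form k d)))).inv.hom
        (toChartRing (form k d) c (isHomogeneous_form k d) b) := by
  have happ : (Spec.map (CommRingCat.ofHom (toChartRing (form k d) c (isHomogeneous_form k d)).toRingHom) ≫
        Proj.awayι (homogeneousSubmodule (Fin (2 + 1 + 1)) k) (X c) (X_mem c) one_pos).appLE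
        (Proj.basicOpen (homogeneousSubmodule (Fin (2 + 1 + 1)) k) (X c)) ⊤ hle =
      (Proj.awayι (homogeneousSubmodule (Fin (2 + 1 + 1)) k) (X c) (X_mem c) one_pos).appLE
          (Proj.basicOpen (homogeneousSubmodule (Fin (2 + 1 + 1)) k) (X c)) ⊤
          (ProjFrac.awayι_preimage_basicOpen_self (X_mem (R := k) c) one_pos).ge ≫
        (Spec.map (CommRingCat.ofHom (toChartRing (form k d) c (isHomogeneous_form k d)).toRingHom)).appLE ⊤ ⊤ le_rfl :=
    (Scheme.Hom.appLE_comp_appLE _ _ _ _ _ _ _).symm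
  have htop : (Spec.map (CommRingCat.ofHom (toChartRing (form k d) c (isHomogeneous_form k d)).toRingHom)).appLE ⊤ ⊤ le_rfl =
      (Spec.map (CommRingCat.ofHom (toChartRing (form k d) c (isHomogeneous_form k d)).toRingHom)).appTop :=
    (Scheme.Hom.app_eq_appLE _).symm
  rw [happ, ProjFrac.appLE_awayι_eq_resAway, htop, CategoryTheory.ConcreteCategory.comp_apply,
    ProjFrac.resAway_awayToSection]
  have hnat := Scheme.ΓSpecIso_inv_naturality
    (CommRingCat.ofHom (toChartRing (form k d) c (isHomogeneous_form k d)).toRingHom)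
  exact (congrArg (fun f => f.hom b) hnat).symm

include hfkC hfkX in
/-- **THE CENTRE ON THE CHART**: the pull-back of `Λ = ker Proj(f_k)` along `Spec (ChartRing F_d c) → H_d ↪ ℙ³_k` is the ideal sheaf of
`(x₁/x_c, x₂/x_c, x₃/x_c) ⊆ ChartRing F_d c` (`Limits.ideal_comap_eq_map`, `LinearCentre.ker_projMap_kill_ideal_basicOpen`,
`appLE_chart_awayToSection`). [folklore] -/
theorem comap_chart_eq_ofIdealTop :
    (((Proj.map fk hfk').ker.comap (hypersurfaceι (form k d)).left).comap
        (chart (form k d) c (isHomogeneous_form k d) hd).left :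
        (Spec (CommRingCat.of (ChartRing (form k d) c (isHomogeneous_form k d)))).IdealSheafData) =
      ofIdealTop ((Ideal.span (Set.range fun c' : {c' : Fin (0 + 3 + 1) // 0 + 1 ≤ (c' : ℕ)} =>
        tautVec (form k d) c (isHomogeneous_form k d) c'.1)).map
        (Scheme.ΓSpecIso (CommRingCat.of (ChartRing (form k d) c (isHomogeneous_form k d)))).inv.hom) := by
  haveI : IsAffine (Comma.left (specOver k (ChartRing (form k d) c (isHomogeneous_form k d)))) :=
    inferInstanceAs (IsAffine (Spec (CommRingCat.of (ChartRing (form k d) c (isHomogeneous_form k d)))))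
  set π := Spec.map (CommRingCat.ofHom (toChartRing (form k d) c (isHomogeneous_form k d)).toRingHom) ≫
    Proj.awayι (homogeneousSubmodule (Fin (2 + 1 + 1)) k) (X c) (X_mem c) one_pos with hπ
  have hcomp : ((Proj.map fk hfk').ker.comap (hypersurfaceι (form k d)).left).comap
      (chart (form k d) c (isHomogeneous_form k d) hd).left = (Proj.map fk hfk').ker.comap π := by
    rw [← Scheme.IdealSheafData.comap_comp]
    exact congrArg (fun f => (Proj.map fk hfk').ker.comap f) (chart_left_comp_ι k d hd c)
  refine hcomp.trans ?_
  let D : (Proj (homogeneousSubmodule (Fin (0 + 3 + 1)) k)).affineOpens :=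
    ⟨Proj.basicOpen (homogeneousSubmodule (Fin (0 + 3 + 1)) k) (X c),
      Proj.isAffineOpen_basicOpen _ (X c) (EquisingularLift.StrataSplit.LinearCentre.X_mem_one (r := 0) (m := 3) c) one_pos⟩
  have hV : ((⟨⊤, isAffineOpen_top _⟩ : (Spec (CommRingCat.of (ChartRing (form k d) c (isHomogeneous_form k d)))).affineOpens) :
      (Spec (CommRingCat.of (ChartRing (form k d) c (isHomogeneous_form k d)))).Opens) = π ⁻¹ᵁ (D : (Proj _).Opens) := by
    change ⊤ = Spec.map _ ⁻¹ᵁ (Proj.awayι (homogeneousSubmodule (Fin (2 + 1 + 1)) k) (X c) (X_mem c) one_pos ⁻¹ᵁ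
      Proj.basicOpen (homogeneousSubmodule (Fin (2 + 1 + 1)) k) (X c))
    rw [ProjFrac.awayι_preimage_basicOpen_self (X_mem (R := k) c) one_pos]
    rfl
  apply Scheme.IdealSheafData.ext_of_isAffine
  rw [ideal_ofIdealTop_top, Literature.AlgebraicGeometry.Limits.ideal_comap_eq_map π _ D _ hV,
    EquisingularLift.StrataSplit.LinearCentre.ker_projMap_kill_ideal_basicOpen (r := 0) (m := 3) fk hfk' hfkC hfkX c, Ideal.map_span, Ideal.map_span,
    ← Set.range_comp, ← Set.range_comp]
  refine congrArg Ideal.span (congrArg Set.range (funext fun c' => ?_))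
  simp only [Function.comp_apply]
  rw [appLE_chart_awayToSection]
  rfl

end Chart

/-! ## Every blow-up of `H_d` along `Λ · 𝒪_{H_d}` is regular -/

section Down

variable (fk : homogeneousSubmodule (Fin (0 + 3 + 1)) k →+*ᵍ homogeneousSubmodule (Fin (0 + 1)) k)
  (hfk' : HomogeneousIdeal.irrelevant (homogeneousSubmodule (Fin (0 + 1)) k) ≤
    (HomogeneousIdeal.irrelevant (homogeneousSubmodule (Fin (0 + 3 + 1)) k)).map fk) (hfkC : ∀ a : k, fk (C a) = C a)
  (hfkX : ∀ i : Fin (0 + 3 + 1), fk (X i) = if h : (i : ℕ) < 0 + 1 then X ⟨i, h⟩ else 0)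

include hfkC hfkX in
/-- **`Bl_vertex H_d` IS REGULAR, for every blow-up**: every blow-up `ρ : Z → H_d` of the Fermat cone along the trace `Λ · 𝒪_{H_d}` of the
linear centre `Λ = V₊(x₁, x₂, x₃)` is a regular scheme (`k` algebraically closed, `d ≠ 0` in `k`). Over `D₊(x_c)` it is a blow-up of
`Spec (ChartRing F_d c)` along `(x₁/x_c, x₂/x_c, x₃/x_c)~`; for `c ≠ 0` that ideal is `(1)` and the blow-up is an isomorphism onto the regular
`Spec (ChartRing F_d c)`; for `c = 0` the charts at the generators (Stacks 0804) are spectra of regular rings. [folklore; Stacks 0804, GW 13.96] -/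
theorem isRegular_of_isBlowup_comap [IsAlgClosed k] (hdk : (d : k) ≠ 0) (Z : Scheme.{0}) (ρ : Z ⟶ (hypersurface (form k d)).left)
    (hρ : IsBlowup ρ (((Proj.map fk hfk').ker.comap (hypersurfaceι (form k d)).left))) : Scheme.IsRegular Z := by
  have hd : 0 < d := Nat.pos_of_ne_zero (by rintro rfl; exact hdk (by simp))
  intro z
  obtain ⟨c, hc⟩ := WhitneyCubic.exists_mem_basicOpen k ((hypersurfaceι (form k d)).left (ρ z))
  let U : (hypersurface (form k d)).left.Opens :=
    (hypersurfaceι (form k d)).left ⁻¹ᵁ Proj.basicOpen (homogeneousSubmodule (Fin (2 + 1 + 1)) k) (X c)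
  have hzU : ρ z ∈ U := hc
  have hrange : Set.range (chart (form k d) c (isHomogeneous_form k d) hd).left = Set.range U.ι := by
    rw [range_chart_left, Scheme.Opens.range_ι]
  let e := IsOpenImmersion.isoOfRangeEq (chart (form k d) c (isHomogeneous_form k d) hd).left U.ι hrange
  have he : e.hom ≫ U.ι = (chart (form k d) c (isHomogeneous_form k d) hd).left :=
    IsOpenImmersion.isoOfRangeEq_hom_fac _ _ _
  -- the restricted blow-up, moved to `Spec (ChartRing F c)`
  have hρU : IsBlowup ((ρ ∣_ U) ≫ e.symm.hom) (ofIdealTop ((Ideal.span (Set.range fun c' : {c' : Fin (0 + 3 + 1) // 0 + 1 ≤ (c' : ℕ)} =>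
      tautVec (form k d) c (isHomogeneous_form k d) c'.1)).map
      (Scheme.ΓSpecIso (CommRingCat.of (ChartRing (form k d) c (isHomogeneous_form k d)))).inv.hom)) := by
    have h := (hρ.restrict U).comp_iso e.symm
    rw [← Scheme.IdealSheafData.comap_comp, Iso.symm_inv, he] at h
    exact WhitneyCubic.isBlowup_of_ideal_eq h (comap_chart_eq_ofIdealTop k d fk hfk' hfkC hfkX hd c)
  -- the stalk of `Z` at `z` is the stalk of the open piece `ρ⁻¹ U` at `⟨z, _⟩`
  haveI : IsIso ((ρ ⁻¹ᵁ U).ι.stalkMap ⟨z, hzU⟩) := inferInstance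
  suffices hst : IsRegularLocalRing ((↑(ρ ⁻¹ᵁ U) : Scheme.{0}).presheaf.stalk ⟨z, hzU⟩) from by
    haveI := hst
    exact IsRegularLocalRing.of_ringEquiv (asIso ((ρ ⁻¹ᵁ U).ι.stalkMap ⟨z, hzU⟩)).commRingCatIsoToRingEquiv.symm
  by_cases hc0 : c = 0
  · -- `c = 0`: the charts at the generators are spectra of regular rings
    subst hc0
    obtain ⟨j, φ, hφ, hzφ, -⟩ := IsBlowup.exists_chart_of_span_range_eq hρU
      (fun c' : {c' : Fin (0 + 3 + 1) // 0 + 1 ≤ (c' : ℕ)} => tautVec (form k d) 0 (isHomogeneous_form k d) c'.1) rfl ⟨z, hzU⟩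
    obtain ⟨w, hw⟩ := hzφ
    haveI := isRegularRing_blowupAlgebra_tautVec k d hdk j.1 j.2
    by_contra hz
    rw [← hw] at hz
    exact not_isRegularLocalRing_localization_of_stalk φ w hz inferInstance
  · -- `c ≠ 0`: the centre is the unit ideal, the blow-up is an isomorphism onto the regular `Spec (ChartRing F c)`
    have hc1 : 0 + 1 ≤ (c : ℕ) := by
      have : (c : ℕ) ≠ 0 := fun h => hc0 (Fin.ext h)
      omega
    have htop : Ideal.span (Set.range fun c' : {c' : Fin (0 + 3 + 1) // 0 + 1 ≤ (c' : ℕ)} =>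
        tautVec (form k d) c (isHomogeneous_form k d) c'.1) = ⊤ :=
      Ideal.eq_top_of_isUnit_mem _ (Ideal.subset_span ⟨⟨c, hc1⟩, rfl⟩)
        (by rw [show (fun c' : {c' : Fin (0 + 3 + 1) // 0 + 1 ≤ (c' : ℕ)} => tautVec (form k d) c (isHomogeneous_form k d) c'.1)
          ⟨c, hc1⟩ = tautVec (form k d) c (isHomogeneous_form k d) c from rfl, tautVec_self]; exact isUnit_one)
    have hI : ofIdealTop ((Ideal.span (Set.range fun c' : {c' : Fin (0 + 3 + 1) // 0 + 1 ≤ (c' : ℕ)} =>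
        tautVec (form k d) c (isHomogeneous_form k d) c'.1)).map
        (Scheme.ΓSpecIso (CommRingCat.of (ChartRing (form k d) c (isHomogeneous_form k d)))).inv.hom) = ⊤ := by
      rw [htop, Ideal.map_top]
      exact Scheme.IdealSheafData.ext_of_isAffine (by rw [ideal_ofIdealTop_top]; rfl)
    have hρU' : IsBlowup ((ρ ∣_ U) ≫ e.symm.hom)
        (⊤ : (Spec (CommRingCat.of (ChartRing (form k d) c (isHomogeneous_form k d)))).IdealSheafData) := by
      rw [← hI]
      exact hρU
    haveI : IsIso ((ρ ∣_ U) ≫ e.symm.hom) := hρU'.isIso isEffectiveCartier_top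
    haveI : IsRegularRing (ChartRing (form k d) c (isHomogeneous_form k d)) := isRegularRing_chartRing_of_ne_zero k d hdk c hc0
    haveI : IsRegularLocalRing ((Spec (CommRingCat.of (ChartRing (form k d) c (isHomogeneous_form k d)))).presheaf.stalk
        (((ρ ∣_ U) ≫ e.symm.hom) ⟨z, hzU⟩)) :=
      Scheme.isRegular_Spec (CommRingCat.of (ChartRing (form k d) c (isHomogeneous_form k d))) (((ρ ∣_ U) ≫ e.symm.hom) ⟨z, hzU⟩)
    exact IsRegularLocalRing.of_ringEquiv
      (R := (Spec (CommRingCat.of (ChartRing (form k d) c (isHomogeneous_form k d)))).presheaf.stalk (((ρ ∣_ U) ≫ e.symm.hom) ⟨z, hzU⟩))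
      (asIso (((ρ ∣_ U) ≫ e.symm.hom).stalkMap ⟨z, hzU⟩)).commRingCatIsoToRingEquiv

end Down

/-! ## EL♮ for the Fermat cones -/

/-- **EL♮ HOLDS FOR EVERY FERMAT CONE `H_d = V₊(x₁ᵈ + x₂ᵈ + x₃ᵈ) ⊂ ℙ³_k`** (`k` algebraically closed of characteristic `p`, `d ≠ 0` in `k`,
i.e. `p ∤ d`, `d ≥ 1`): `Theorems.EquisingularLift.ELNatAt p k 3 H_d ι` (p503491) — the `∃ (O, π, P′, σ, S′)` body of the item
`EquisingularLiftNat` at this `H`. Witnesses: `O = 𝕎(k)` (`stub_wittRing`), ONE blow-up of `ℙ³_O` along the `O`-point `C = V(x₁, x₂, x₃) =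
ker Proj(f_O)` = the section through the vertex (regular `≅ Spec O`, `O`-flat; `C · 𝒪_{ℙ³_k} = Λ = ker Proj(f_k)` by
`LinearCentre.comap_ker_projMap_kill`); E1 since `V(Λ) ⊆ V₊(F_d)`; off the generic point since `(F_d) ∉ V(Λ)`; and DOWNSTAIRS every blow-up of
`H_d` along `Λ · 𝒪_{H_d}` is regular (`isRegular_of_isBlowup_comap`). Assembled by `elNatAt_of_oneStep₀` (p505461), exactly as pv-022's
`WhitneyCubic.elNatAt_whitneyCubic` (p511043) with `(r, m) = (0, 3)`. [OURS · L1 W4.5b] [folklore] -/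
theorem elNatAt_fermatCone (p : ℕ) (hp : p.Prime) (K : Type) [Field K] [CharP K p] [IsAlgClosed K] (hdK : (d : K) ≠ 0) :
    Theorems.EquisingularLift.ELNatAt p K 3 (hypersurface (form K d)).left (hypersurfaceι (form K d)).left := by
  classical
  have hd : 0 < d := Nat.pos_of_ne_zero (by rintro rfl; exact hdK (by simp))
  obtain ⟨O, i1, i2, i3, i4, -, -, π, hπ⟩ := stub_wittRing p hp K
  obtain ⟨fO, hfO', hfOC, hfOX⟩ := EquisingularLift.StrataSplit.LinearCentre.exists_kill O 0 3
  obtain ⟨fk, hfk', hfkC, hfkX⟩ := EquisingularLift.StrataSplit.LinearCentre.exists_kill K 0 3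
  haveI := isIntegral_hypersurface K d hdK
  -- the centre `C = ker Proj(f_O)`: regular (`≅ ℙ⁰_O`) and `O`-flat — as in `LinearCentre.EL_of_linearCentre`
  obtain ⟨hsmr, -⟩ := stub_projectiveAmbientSmoothProper O 0
  set iO : Proj (homogeneousSubmodule (Fin (0 + 1)) O) ⟶ Proj (homogeneousSubmodule (Fin (0 + 3 + 1)) O) :=
    Proj.map fO hfO' with hiOdef
  haveI : IsClosedImmersion iO :=
    Literature.AlgebraicGeometry.FundamentalGroup.isClosedImmersion_projMap_of_surjective fO hfO'
      (EquisingularLift.StrataSplit.LinearCentre.kill_surjective (r := 0) (m := 3) fO.toRingHom (fun a => hfOC a) (fun i => hfOX i))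
  have hRr : Scheme.IsRegular (Proj (homogeneousSubmodule (Fin (0 + 1)) O)) := fun y =>
    (stub_goodAtOfSmooth O _ _ hsmr y).1
  have hCreg : Scheme.IsRegular iO.ker.subscheme := hRr.of_iso iO.toImage
  have hCflat : Flat (iO.ker.subschemeι ≫ Proj.toSpecZero (homogeneousSubmodule (Fin (0 + 3 + 1)) O) ≫
      Spec.map (CommRingCat.ofHom (algebraMap O (homogeneousSubmodule (Fin (0 + 3 + 1)) O 0)))) := by
    have h1 : iO.toImage ≫ iO.ker.subschemeι ≫ (Proj.toSpecZero (homogeneousSubmodule (Fin (0 + 3 + 1)) O) ≫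
        Spec.map (CommRingCat.ofHom (algebraMap O (homogeneousSubmodule (Fin (0 + 3 + 1)) O 0)))) =
        Proj.toSpecZero (homogeneousSubmodule (Fin (0 + 1)) O) ≫
          Spec.map (CommRingCat.ofHom (algebraMap O (homogeneousSubmodule (Fin (0 + 1)) O 0))) := by
      rw [← Category.assoc]
      change (iO.toImage ≫ iO.imageι) ≫ _ = _
      rw [Scheme.Hom.toImage_imageι]
      exact EquisingularLift.StrataSplit.LinearCentre.projMap_kill_comp_structureMap (r := 0) (m := 3) fO hfO' hfOC hfOX
    haveI := hsmr
    have h2 : Flat (iO.toImage ≫ iO.ker.subschemeι ≫ (Proj.toSpecZero (homogeneousSubmodule (Fin (0 + 3 + 1)) O) ≫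
        Spec.map (CommRingCat.ofHom (algebraMap O (homogeneousSubmodule (Fin (0 + 3 + 1)) O 0))))) := by
      rw [h1]; infer_instance
    exact (MorphismProperty.cancel_left_of_respectsIso @Flat iO.toImage _).mp h2
  -- `n` is spelled `0 + 3` so that `Fin (n + 1)` is literally the kill maps' `Fin (0 + 3 + 1)` (cheap unification)
  refine elNatAt_of_oneStep₀ K (0 + 3) _ (hypersurfaceι (form K d)).left O π hπ iO.ker hCreg hCflat (Proj.map fk hfk').ker
    ?_ ?_ ?_ ?_
  · intro φ hφ' hφ
    exact EquisingularLift.StrataSplit.LinearCentre.comap_ker_projMap_kill (r := 0) (m := 3) π hπ φ hφ hφ' fO hfO' hfOC hfOX fk hfk' hfkC hfkX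
  · exact not_range_subset_support K d fk hfk' hfkC hfkX hdK
  · exact support_subset_range K d fk hfk' hfkC hfkX hd
  · intro Z ρ hρ
    exact isRegular_of_isBlowup_comap K d fk hfk' hfkC hfkX hdK Z ρ hρ

end FermatCone

end Summit.ResolutionOfSingularities.ResolutionOfSingularities.Cruxes.EquisingularLiftNat.Sections

end
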